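import Mathlib.AlgebraicGeometry.EllipticCurve.Affine.Point
import Mathlib.RingTheory.Nullstellensatz
import Mathlib.Tactic.ComputeDegree
import Mathlib.FieldTheory.IsAlgClosed.AlgebraicClosure
import Literature.NumberTheory.EllipticCurves.GaloisAction
import HarnessLib

/-!
# Specialization of points of `E(M)`, `M ⊇ K̄`, to points of `E(K̄)` (Hilbert's Nullstellensatz)

Topic `NumberTheory/EllipticCurves` (trunk T-ELLARITH). A tool file serving the proof of the named
fact `WeierstrassCurve.Isogeny.hasLocalPointsMaps` of `ShaIsogeny.lean` (an isogeny defined over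
`K`, recorded in the tree by its action on `K̄`-points, acts additively and Galois-equivariantly
on the points over every field `M ⊇ K̄`; files `IsogenyBaseChange`, `ShaIsogenyProofs`). The
tree's isogenies (`Literature.NumberTheory.EllipticCurves.Isogeny`) are additive maps on
`E(K̄)` agreeing with a rational map off a finite set, so every identity about their extension to
`E(M)` has to be *pulled back from `E(K̄)`*. This file provides the pull-back device:
**specialization of finitely many elements of `M` to `K̄` by a `K̄`-algebra homomorphism**.

For a field `M` which is an algebra over an algebraically closed field `k` and a finite set
`S ⊆ M`, the `k`-subalgebra `A = k[S, S⁻¹] ⊆ M` is finitely generated, hence (weak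
Nullstellensatz, Mathlib's `MvPolynomial.isMaximal_iff_eq_vanishingIdeal_singleton`) admits a
`k`-algebra homomorphism `s : A → k` (`exists_algHom_of_finset`, `exists_stocked`). Extended by
the junk value `0` off `A` it is the *specialization* `spec s : M → k`: a ring homomorphism on `A`
fixing `k`, and — the point of inverting `S` — **an element of `S` specializes to `0` iff it is
`0`** (`Stocked.spec_eq_zero_iff`). Consequently every finite configuration of points of `E(M)`
and `E'(M)` together with the finitely many quantities deciding the branches of the addition law,
the (non-)vanishing of denominators and the (in)equality of coordinates can be specialized to
`E(K̄)`, `E'(K̄)` preserving all these relations: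

* `WeierstrassCurve.specPt s : E(M) → E(K̄)`, `(x, y) ↦ (spec x, spec y)` (`O ↦ O`), is the
  affine
  point `(spec x, spec y)` on every point whose *stock* `ptStock` (coordinates and the two partial
  derivatives, one of which is non-zero) is inverted in `A` (`specPt_some`, `nonsingular_spec`);
* it fixes `ι_* E(K̄)` (`specPt_map`);
* **it is additive** on `P, Q` as soon as `x_P - x_Q` and `y_P - negY(Q)` are stocked
  (`specPt_add`: Mathlib's addition law is given by the same formulae `addX`, `addY`, `slope` over
  `M` and over `K̄`, `map_addX`/`baseChange_addX` etc., and the stock makes `spec` take the same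
  branch);
* **it separates** stocked points whose coordinate differences are stocked (`eq_of_specPt_eq`).

Finally, `K̄` being algebraically closed in `M` (`mem_range_algebraMap_of_isIntegral`), an affine
point of `E(M)` not coming from `E(K̄)` ("generic") has *both* coordinates outside `K̄`, the
Weierstrass equation being monic in `y` and in `x` (`not_mem_range_of_not_mem_range_map`); so
`x_P - c ≠ 0` for every `c ∈ K̄`, and stocking finitely many of these differences makes the
specialization of `P` avoid any given finite subset of `E(K̄)` (`spec_not_mem_of_stocked`) — in
the application, the exceptional set of a rational representation of the isogeny.

## Main statements

* `Literature.NumberTheory.EllipticCurves.Specialization.exists_algHom_of_finset`, `exists_stocked`: `k`-points of finitely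
  generated `k`-subalgebras of `M` containing prescribed inverses (Nullstellensatz).
* `Literature.NumberTheory.EllipticCurves.Specialization.spec`, `spec_add`/`_mul`/`_inv`/`_div`/`_aeval`, `Stocked`,
  `Stocked.spec_eq_zero_iff`.
* `WeierstrassCurve.specPt`, `specPt_some`, `specPt_map`, **`specPt_add`**, **`eq_of_specPt_eq`**.
* `WeierstrassCurve.some_mem_range_map_iff`, `not_mem_range_of_not_mem_range_map`,
  `spec_not_mem_of_stocked`.

## References

The argument is the classical principle that algebraic identities between points with
coordinates in a finitely generated `k`-algebra can be checked at its `k`-points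
(A. Weil, *Foundations of Algebraic Geometry* (1946), Ch. II "specializations"; for the
Nullstellensatz: Atiyah–Macdonald, *Introduction to Commutative Algebra*, Cor. 5.24 and
Ex. 5.17–5.19); the addition law is Silverman, *The Arithmetic of Elliptic Curves*, III.2.3.
All statements here are routine and tagged `[folklore]`.

## Design notes

* `k` is an arbitrary algebraically closed field in `namespace Literature.Specialization`; for points it
  is `K̄ = AlgebraicClosure K` (the field of the tree's `geomPoints`), `M` any field with
  `[Algebra K M] [Algebra K̄ M] [IsScalarTower K K̄ M]`, and `ι_* = Affine.Point.map
  (IsScalarTower.toAlgHom K K̄ M)`; the consumer instantiates `M = K̄_E` with the `K̄`-algebra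
  structure of the chosen embedding `Literature.closureEmb E`.
* `spec` and `specPt` are total functions with junk value `0`/`O` off `A` / off nonsingular
  specializations; all lemmas carry the stock hypotheses under which no junk occurs. Stocks are
  `Finset`s so that the consumer can take unions and peel them off with `Stocked.left/right`.
* Transport of the Weierstrass quantities along `spec` goes through the curve `W ⊗ A` over the
  subalgebra and Mathlib's `baseChange_polynomial(X/Y)`, `baseChange_negY/addX/addY` for the two
  algebra maps `A → M` and `s : A → K̄`.
* `noncomputable section`, `open scoped Classical`, `K : Type u`, `M : Type v`; curve-specific
  declarations are dot-notation extensions in `namespace WeierstrassCurve`.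
-/

noncomputable section

open scoped Classical

universe u v

namespace Literature.NumberTheory.EllipticCurves

namespace Specialization

variable {k : Type u} [Field k] {M : Type v} [Field M] [Algebra k M]

/-- **Finitely generated `k`-subalgebras of a field extension of an algebraically closed field `k`
have `k`-points** (Hilbert's Nullstellensatz): for every finite `S ⊆ M` there are a `k`-subalgebra
`A ⊆ M` containing `S` and the inverses of the elements of `S`, and a `k`-algebra homomorphism
`A → k`. [folklore] -/
theorem exists_algHom_of_finset [IsAlgClosed k] (S : Finset M) :
    ∃ (A : Subalgebra k M) (_ : A →ₐ[k] k), ∀ u ∈ S, u ∈ A ∧ u⁻¹ ∈ A := by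
  let T : Set M := (S : Set M) ∪ (fun u ↦ u⁻¹) '' (S : Set M)
  haveI : Finite T := (S.finite_toSet.union (S.finite_toSet.image _)).to_subtype
  let f : MvPolynomial T k →ₐ[k] M := MvPolynomial.aeval ((↑) : T → M)
  have hA : Algebra.adjoin k T = f.range := Algebra.adjoin_eq_range k T
  have hI : RingHom.ker f ≠ ⊤ := RingHom.ker_ne_top f
  obtain ⟨m, hm, hIm⟩ := Ideal.exists_le_maximal _ hI
  obtain ⟨a, rfl⟩ := (MvPolynomial.isMaximal_iff_eq_vanishingIdeal_singleton (K := k)).mp hm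
  let g : MvPolynomial T k →ₐ[k] k := MvPolynomial.aeval a
  have hg : ∀ p ∈ RingHom.ker f, g p = 0 := fun p hp ↦
    (MvPolynomial.mem_vanishingIdeal_singleton_iff a p).mp (hIm hp)
  let g' : (MvPolynomial T k ⧸ RingHom.ker f) →ₐ[k] k := Ideal.Quotient.liftₐ _ g hg
  let e : f.range ≃ₐ[k] (MvPolynomial T k ⧸ RingHom.ker f) :=
    (Ideal.quotientKerEquivRange f).symm
  let e' : Algebra.adjoin k T ≃ₐ[k] f.range := Subalgebra.equivOfEq _ _ hA
  refine ⟨Algebra.adjoin k T, (g'.comp e.toAlgHom).comp e'.toAlgHom, fun u hu ↦ ⟨?_, ?_⟩⟩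
  · exact Algebra.subset_adjoin (Or.inl hu)
  · exact Algebra.subset_adjoin (Or.inr ⟨u, hu, rfl⟩)

/-- An element of a field extension of an algebraically closed field `k` which is integral over
`k` lies in `k`. [folklore] -/
theorem mem_range_algebraMap_of_isIntegral [IsAlgClosed k] {x : M} (hx : IsIntegral k x) :
    x ∈ Set.range (algebraMap k M) := by
  refine ⟨-(minpoly k x).coeff 0, ?_⟩
  have hq : (minpoly k x).leadingCoeff = 1 := minpoly.monic hx
  have h : (minpoly k x).degree = 1 :=
    IsAlgClosed.degree_eq_one_of_irreducible k (minpoly.irreducible hx)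
  have : Polynomial.aeval x (minpoly k x) = 0 := minpoly.aeval k x
  rw [Polynomial.eq_X_add_C_of_degree_eq_one h, hq, Polynomial.C_1, one_mul, Polynomial.aeval_add,
    Polynomial.aeval_X, Polynomial.aeval_C, add_eq_zero_iff_eq_neg] at this
  rw [map_neg]
  exact this.symm

/-! ## The specialization map `spec` -/

section Spec

variable {A : Subalgebra k M} (s : A →ₐ[k] k)

/-- The **specialization** attached to a `k`-algebra homomorphism `s : A → k` on a `k`-subalgebra
`A ⊆ M`, as a total function `M → k`: `s` on `A`, the junk value `0` off `A`. [folklore] -/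
def spec (x : M) : k :=
  if hx : x ∈ A then s ⟨x, hx⟩ else 0

/-- `spec` is `s` on `A`. [folklore] -/
theorem spec_coe (a : A) : spec s (a : M) = s a := by
  simp [spec]

/-- `spec` is `s` on `A` (membership form). [folklore] -/
theorem spec_of_mem {x : M} (hx : x ∈ A) : spec s x = s ⟨x, hx⟩ :=
  spec_coe s ⟨x, hx⟩

/-- `spec` fixes `k`. [folklore] -/
@[simp] theorem spec_algebraMap (c : k) : spec s (algebraMap k M c) = c := by
  rw [spec_of_mem s (A.algebraMap_mem c)]
  exact (s.commutes c : _)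

/-- `spec 0 = 0`. [folklore] -/
@[simp] theorem spec_zero : spec s 0 = 0 := by
  simpa using spec_algebraMap s 0

/-- `spec 1 = 1`. [folklore] -/
@[simp] theorem spec_one : spec s 1 = 1 := by
  simpa using spec_algebraMap s 1

/-- `spec` is additive on `A`. [folklore] -/
theorem spec_add {x y : M} (hx : x ∈ A) (hy : y ∈ A) :
    spec s (x + y) = spec s x + spec s y := by
  rw [spec_of_mem s hx, spec_of_mem s hy, spec_of_mem s (add_mem hx hy), ← map_add]; rfl

/-- `spec` is multiplicative on `A`. [folklore] -/
theorem spec_mul {x y : M} (hx : x ∈ A) (hy : y ∈ A) :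
    spec s (x * y) = spec s x * spec s y := by
  rw [spec_of_mem s hx, spec_of_mem s hy, spec_of_mem s (mul_mem hx hy), ← map_mul]; rfl

/-- `spec` commutes with negation on `A`. [folklore] -/
theorem spec_neg {x : M} (hx : x ∈ A) : spec s (-x) = -spec s x := by
  rw [spec_of_mem s hx, spec_of_mem s (neg_mem hx), ← map_neg]; rfl

/-- `spec` commutes with subtraction on `A`. [folklore] -/
theorem spec_sub {x y : M} (hx : x ∈ A) (hy : y ∈ A) :
    spec s (x - y) = spec s x - spec s y := by
  rw [sub_eq_add_neg, spec_add s hx (neg_mem hy), spec_neg s hy, sub_eq_add_neg]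

/-- **The stock preserves (non-)vanishing**: if `u` and `u⁻¹` both lie in `A` then
`spec s u⁻¹ = (spec s u)⁻¹`. [folklore] -/
theorem spec_inv {u : M} (hu : u ∈ A) (hu' : u⁻¹ ∈ A) : spec s u⁻¹ = (spec s u)⁻¹ := by
  by_cases h0 : u = 0
  · subst h0; simp
  · have h1 : spec s u * spec s u⁻¹ = 1 := by
      rw [← spec_mul s hu hu', mul_inv_cancel₀ h0, spec_one]
    exact (eq_inv_of_mul_eq_one_right h1)

/-- An element inverted in `A` specializes to a non-zero element iff it is non-zero. [folklore] -/
theorem spec_ne_zero_iff {u : M} (hu : u ∈ A) (hu' : u⁻¹ ∈ A) :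
    spec s u ≠ 0 ↔ u ≠ 0 := by
  refine ⟨fun h h0 ↦ h (by rw [h0, spec_zero]), fun h0 h ↦ ?_⟩
  have h1 : spec s u * spec s u⁻¹ = 1 := by
    rw [← spec_mul s hu hu', mul_inv_cancel₀ h0, spec_one]
  rw [h, zero_mul] at h1
  exact zero_ne_one h1

/-- An element inverted in `A` specializes to zero iff it is zero. [folklore] -/
theorem spec_eq_zero_iff {u : M} (hu : u ∈ A) (hu' : u⁻¹ ∈ A) : spec s u = 0 ↔ u = 0 := by
  simpa using (spec_ne_zero_iff s hu hu').not

/-- `spec` commutes with division by an element inverted in `A`. [folklore] -/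
theorem spec_div {x u : M} (hx : x ∈ A) (hu : u ∈ A) (hu' : u⁻¹ ∈ A) :
    spec s (x / u) = spec s x / spec s u := by
  rw [div_eq_mul_inv, spec_mul s hx hu', spec_inv s hu hu', div_eq_mul_inv]

/-- `spec` is `s` composed with evaluation on polynomial expressions: for `p ∈ k[X₁, …, Xₙ]`
and `v : ι → A`, `spec s (p(v)) = p(spec s ∘ v)`. [folklore] -/
theorem spec_aeval {ι : Type*} (p : MvPolynomial ι k) (v : ι → M) (hv : ∀ i, v i ∈ A) :
    spec s (MvPolynomial.aeval v p) = MvPolynomial.aeval (fun i ↦ spec s (v i)) p := by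
  set v' : ι → A := fun i ↦ ⟨v i, hv i⟩
  have h1 : MvPolynomial.aeval v p = ((MvPolynomial.aeval v' p : A) : M) := by
    show MvPolynomial.aeval (fun i ↦ A.val (v' i)) p = A.val (MvPolynomial.aeval v' p)
    rw [← MvPolynomial.comp_aeval]
    rfl
  rw [h1, spec_coe, ← AlgHom.comp_apply, MvPolynomial.comp_aeval]
  congr 2
  funext i
  exact (spec_coe s (v' i)).symm

/-- Polynomial expressions in elements of `A` lie in `A`. [folklore] -/
theorem aeval_mem {ι : Type*} (p : MvPolynomial ι k) (v : ι → M) (hv : ∀ i, v i ∈ A) :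
    MvPolynomial.aeval v p ∈ A := by
  set v' : ι → A := fun i ↦ ⟨v i, hv i⟩
  have h1 : MvPolynomial.aeval v p = A.val (MvPolynomial.aeval v' p) := by
    show MvPolynomial.aeval (fun i ↦ A.val (v' i)) p = A.val (MvPolynomial.aeval v' p)
    rw [← MvPolynomial.comp_aeval]
    rfl
  rw [h1]
  exact (MvPolynomial.aeval v' p).2

/-- The entries of `![x, y]` lie in `A` if `x, y` do. [folklore] -/
theorem vec₂_mem {x y : M} (hx : x ∈ A) (hy : y ∈ A) :
    ∀ i, (![x, y] : Fin 2 → M) i ∈ A := by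
  intro i
  fin_cases i
  · exact hx
  · exact hy

/-- Two-variable case of `aeval_mem`. [folklore] -/
theorem aeval_vec₂_mem {x y : M} (hx : x ∈ A) (hy : y ∈ A) (p : MvPolynomial (Fin 2) k) :
    MvPolynomial.aeval ![x, y] p ∈ A :=
  aeval_mem p _ (vec₂_mem hx hy)

/-- Two-variable case of `spec_aeval`: `spec s (p(x, y)) = p(spec s x, spec s y)`. [folklore] -/
theorem spec_aeval_vec₂ {x y : M} (hx : x ∈ A) (hy : y ∈ A) (p : MvPolynomial (Fin 2) k) :
    spec s (MvPolynomial.aeval ![x, y] p) = MvPolynomial.eval ![spec s x, spec s y] p := by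
  rw [spec_aeval s p _ (vec₂_mem hx hy)]
  have : (fun i ↦ spec s ((![x, y] : Fin 2 → M) i)) = ![spec s x, spec s y] := by
    funext i
    fin_cases i <;> rfl
  rw [this]
  rfl

end Spec

/-! ## Stocks: finite sets of elements inverted in `A` -/

/-- `Stocked A S`: every element of the finite set `S ⊆ M` lies in the subalgebra `A` together
with its inverse, so that a specialization `A → k` preserves its (non-)vanishing. [folklore] -/
def Stocked (A : Subalgebra k M) (S : Finset M) : Prop :=
  ∀ u ∈ S, u ∈ A ∧ u⁻¹ ∈ A

/-- `Stocked` is antitone in the finite set. [folklore] -/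
theorem Stocked.mono {A : Subalgebra k M} {S T : Finset M} (h : S ⊆ T) (hT : Stocked A T) :
    Stocked A S :=
  fun u hu ↦ hT u (h hu)

/-- The left part of a stocked union is stocked. [folklore] -/
theorem Stocked.left {A : Subalgebra k M} {S T : Finset M} (h : Stocked A (S ∪ T)) :
    Stocked A S :=
  h.mono Finset.subset_union_left

/-- The right part of a stocked union is stocked. [folklore] -/
theorem Stocked.right {A : Subalgebra k M} {S T : Finset M} (h : Stocked A (S ∪ T)) :
    Stocked A T :=
  h.mono Finset.subset_union_right

/-- Stocked elements lie in `A`. [folklore] -/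
theorem Stocked.mem {A : Subalgebra k M} {S : Finset M} (h : Stocked A S) {u : M} (hu : u ∈ S) :
    u ∈ A :=
  (h u hu).1

/-- The inverses of stocked elements lie in `A`. [folklore] -/
theorem Stocked.inv_mem {A : Subalgebra k M} {S : Finset M} (h : Stocked A S) {u : M}
    (hu : u ∈ S) :
    u⁻¹ ∈ A :=
  (h u hu).2

/-- **Existence of specializations with prescribed stock** (Nullstellensatz). [folklore] -/
theorem exists_stocked [IsAlgClosed k] (S : Finset M) :
    ∃ (A : Subalgebra k M) (_ : A →ₐ[k] k), Stocked A S :=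
  exists_algHom_of_finset S

variable {A : Subalgebra k M} (s : A →ₐ[k] k)

/-- **Stocked elements keep their (non-)vanishing under specialization.** [folklore] -/
theorem Stocked.spec_eq_zero_iff {S : Finset M} (h : Stocked A S) {u : M} (hu : u ∈ S) :
    spec s u = 0 ↔ u = 0 :=
  Literature.NumberTheory.EllipticCurves.Specialization.spec_eq_zero_iff s (h.mem hu) (h.inv_mem hu)

/-- Elements of `A` whose difference is stocked have equal specializations iff they are equal.
[folklore] -/
theorem Stocked.spec_sub_eq_zero_iff {S : Finset M} (h : Stocked A S) {x y : M} (hx : x ∈ A)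
    (hy : y ∈ A) (hu : x - y ∈ S) : spec s x = spec s y ↔ x = y := by
  rw [← sub_eq_zero, ← spec_sub s hx hy, h.spec_eq_zero_iff s hu, sub_eq_zero]

end Specialization

end Literature.NumberTheory.EllipticCurves

namespace WeierstrassCurve

open Affine Literature.NumberTheory.EllipticCurves.Specialization

variable {K : Type u} [Field K] (W : WeierstrassCurve K) {M : Type v} [Field M] [Algebra K M]
  [Algebra (AlgebraicClosure K) M] [IsScalarTower K (AlgebraicClosure K) M]
  {A : Subalgebra (AlgebraicClosure K) M} (s : A →ₐ[AlgebraicClosure K] AlgebraicClosure K)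

/-! ## Transport of the Weierstrass quantities along `spec` -/

section Transport

variable {W}

/-- `spec` of the Weierstrass polynomial at `(x, y) ∈ A²` is the Weierstrass polynomial (over
`K̄`) at `(spec x, spec y)` (through `W ⊗ A`, Mathlib's `baseChange_polynomial` and
`map_mapRingHom_evalEval`).
[folklore] -/
theorem spec_evalEval_polynomial {x y : M} (hx : x ∈ A) (hy : y ∈ A) :
    spec s ((W.baseChange M).toAffine.polynomial.evalEval x y) =
      (W.baseChange (AlgebraicClosure K)).toAffine.polynomial.evalEval (spec s x) (spec s y) := by
  obtain ⟨x, rfl⟩ : ∃ x' : A, (x' : M) = x := ⟨⟨x, hx⟩, rfl⟩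
  obtain ⟨y, rfl⟩ : ∃ y' : A, (y' : M) = y := ⟨⟨y, hy⟩, rfl⟩
  have h1 : (W.baseChange M).toAffine.polynomial.evalEval (x : M) (y : M) =
      (((W.baseChange A).toAffine.polynomial.evalEval x y : A) : M) := by
    rw [WeierstrassCurve.Affine.baseChange_polynomial (W := W) (f := A.val)]
    exact Polynomial.map_mapRingHom_evalEval (A.val : A →+* M) _ x y
  have h2 : s ((W.baseChange A).toAffine.polynomial.evalEval x y) =
      (W.baseChange (AlgebraicClosure K)).toAffine.polynomial.evalEval (s x) (s y) := by
    rw [WeierstrassCurve.Affine.baseChange_polynomial (W := W) (f := s)]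
    exact (Polynomial.map_mapRingHom_evalEval (s : A →+* AlgebraicClosure K) _ x y).symm
  rw [h1, spec_coe, h2, spec_coe, spec_coe]

/-- `spec` commutes with the partial derivative `W_X` at points of `A²`. [folklore] -/
theorem spec_evalEval_polynomialX {x y : M} (hx : x ∈ A) (hy : y ∈ A) :
    spec s ((W.baseChange M).toAffine.polynomialX.evalEval x y) =
      (W.baseChange (AlgebraicClosure K)).toAffine.polynomialX.evalEval (spec s x) (spec s y) := by
  obtain ⟨x, rfl⟩ : ∃ x' : A, (x' : M) = x := ⟨⟨x, hx⟩, rfl⟩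
  obtain ⟨y, rfl⟩ : ∃ y' : A, (y' : M) = y := ⟨⟨y, hy⟩, rfl⟩
  have h1 : (W.baseChange M).toAffine.polynomialX.evalEval (x : M) (y : M) =
      (((W.baseChange A).toAffine.polynomialX.evalEval x y : A) : M) := by
    rw [WeierstrassCurve.Affine.baseChange_polynomialX (W := W) (f := A.val)]
    exact Polynomial.map_mapRingHom_evalEval (A.val : A →+* M) _ x y
  have h2 : s ((W.baseChange A).toAffine.polynomialX.evalEval x y) =
      (W.baseChange (AlgebraicClosure K)).toAffine.polynomialX.evalEval (s x) (s y) := by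
    rw [WeierstrassCurve.Affine.baseChange_polynomialX (W := W) (f := s)]
    exact (Polynomial.map_mapRingHom_evalEval (s : A →+* AlgebraicClosure K) _ x y).symm
  rw [h1, spec_coe, h2, spec_coe, spec_coe]

/-- `spec` commutes with the partial derivative `W_Y` at points of `A²`. [folklore] -/
theorem spec_evalEval_polynomialY {x y : M} (hx : x ∈ A) (hy : y ∈ A) :
    spec s ((W.baseChange M).toAffine.polynomialY.evalEval x y) =
      (W.baseChange (AlgebraicClosure K)).toAffine.polynomialY.evalEval (spec s x) (spec s y) := by
  obtain ⟨x, rfl⟩ : ∃ x' : A, (x' : M) = x := ⟨⟨x, hx⟩, rfl⟩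
  obtain ⟨y, rfl⟩ : ∃ y' : A, (y' : M) = y := ⟨⟨y, hy⟩, rfl⟩
  have h1 : (W.baseChange M).toAffine.polynomialY.evalEval (x : M) (y : M) =
      (((W.baseChange A).toAffine.polynomialY.evalEval x y : A) : M) := by
    rw [WeierstrassCurve.Affine.baseChange_polynomialY (W := W) (f := A.val)]
    exact Polynomial.map_mapRingHom_evalEval (A.val : A →+* M) _ x y
  have h2 : s ((W.baseChange A).toAffine.polynomialY.evalEval x y) =
      (W.baseChange (AlgebraicClosure K)).toAffine.polynomialY.evalEval (s x) (s y) := by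
    rw [WeierstrassCurve.Affine.baseChange_polynomialY (W := W) (f := s)]
    exact (Polynomial.map_mapRingHom_evalEval (s : A →+* AlgebraicClosure K) _ x y).symm
  rw [h1, spec_coe, h2, spec_coe, spec_coe]

/-- `spec` commutes with `negY` at points of `A²` (Mathlib's `baseChange_negY`). [folklore] -/
theorem spec_negY {x y : M} (hx : x ∈ A) (hy : y ∈ A) :
    spec s ((W.baseChange M).toAffine.negY x y) =
      (W.baseChange (AlgebraicClosure K)).toAffine.negY (spec s x) (spec s y) := by
  obtain ⟨x, rfl⟩ : ∃ x' : A, (x' : M) = x := ⟨⟨x, hx⟩, rfl⟩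
  obtain ⟨y, rfl⟩ : ∃ y' : A, (y' : M) = y := ⟨⟨y, hy⟩, rfl⟩
  have h1 : (W.baseChange M).toAffine.negY (x : M) (y : M) =
      (((W.baseChange A).toAffine.negY x y : A) : M) :=
    WeierstrassCurve.Affine.baseChange_negY (W' := W) A.val x y
  have h2 : s ((W.baseChange A).toAffine.negY x y) =
      (W.baseChange (AlgebraicClosure K)).toAffine.negY (s x) (s y) :=
    (WeierstrassCurve.Affine.baseChange_negY (W' := W) s x y).symm
  rw [h1, spec_coe, h2, spec_coe, spec_coe]

/-- `negY` of a point of `A²` lies in `A`. [folklore] -/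
theorem negY_mem {x y : M} (hx : x ∈ A) (hy : y ∈ A) :
    (W.baseChange M).toAffine.negY x y ∈ A := by
  obtain ⟨x, rfl⟩ : ∃ x' : A, (x' : M) = x := ⟨⟨x, hx⟩, rfl⟩
  obtain ⟨y, rfl⟩ : ∃ y' : A, (y' : M) = y := ⟨⟨y, hy⟩, rfl⟩
  rw [show (W.baseChange M).toAffine.negY (x : M) (y : M) =
      (((W.baseChange A).toAffine.negY x y : A) : M) from
    WeierstrassCurve.Affine.baseChange_negY (W' := W) A.val x y]
  exact SetLike.coe_mem _

/-- `spec` commutes with the addition formula `addX` on `A` (Mathlib's `baseChange_addX`).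
[folklore] -/
theorem spec_addX {x₁ x₂ ℓ : M} (hx₁ : x₁ ∈ A) (hx₂ : x₂ ∈ A) (hℓ : ℓ ∈ A) :
    spec s ((W.baseChange M).toAffine.addX x₁ x₂ ℓ) =
      (W.baseChange (AlgebraicClosure K)).toAffine.addX (spec s x₁) (spec s x₂)
        (spec s ℓ) := by
  obtain ⟨x₁, rfl⟩ : ∃ x' : A, (x' : M) = x₁ := ⟨⟨x₁, hx₁⟩, rfl⟩
  obtain ⟨x₂, rfl⟩ : ∃ x' : A, (x' : M) = x₂ := ⟨⟨x₂, hx₂⟩, rfl⟩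
  obtain ⟨ℓ, rfl⟩ : ∃ x' : A, (x' : M) = ℓ := ⟨⟨ℓ, hℓ⟩, rfl⟩
  have h1 : (W.baseChange M).toAffine.addX (x₁ : M) (x₂ : M) (ℓ : M) =
      (((W.baseChange A).toAffine.addX x₁ x₂ ℓ : A) : M) :=
    WeierstrassCurve.Affine.baseChange_addX (W' := W) A.val x₁ x₂ ℓ
  have h2 : s ((W.baseChange A).toAffine.addX x₁ x₂ ℓ) =
      (W.baseChange (AlgebraicClosure K)).toAffine.addX (s x₁) (s x₂) (s ℓ) :=
    (WeierstrassCurve.Affine.baseChange_addX (W' := W) s x₁ x₂ ℓ).symm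
  rw [h1, spec_coe, h2, spec_coe, spec_coe, spec_coe]

/-- `addX` of elements of `A` lies in `A`. [folklore] -/
theorem addX_mem {x₁ x₂ ℓ : M} (hx₁ : x₁ ∈ A) (hx₂ : x₂ ∈ A) (hℓ : ℓ ∈ A) :
    (W.baseChange M).toAffine.addX x₁ x₂ ℓ ∈ A := by
  obtain ⟨x₁, rfl⟩ : ∃ x' : A, (x' : M) = x₁ := ⟨⟨x₁, hx₁⟩, rfl⟩
  obtain ⟨x₂, rfl⟩ : ∃ x' : A, (x' : M) = x₂ := ⟨⟨x₂, hx₂⟩, rfl⟩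
  obtain ⟨ℓ, rfl⟩ : ∃ x' : A, (x' : M) = ℓ := ⟨⟨ℓ, hℓ⟩, rfl⟩
  rw [show (W.baseChange M).toAffine.addX (x₁ : M) (x₂ : M) (ℓ : M) =
      (((W.baseChange A).toAffine.addX x₁ x₂ ℓ : A) : M) from
    WeierstrassCurve.Affine.baseChange_addX (W' := W) A.val x₁ x₂ ℓ]
  exact SetLike.coe_mem _

/-- `spec` commutes with the addition formula `addY` on `A` (Mathlib's `baseChange_addY`).
[folklore] -/
theorem spec_addY {x₁ x₂ y₁ ℓ : M} (hx₁ : x₁ ∈ A) (hx₂ : x₂ ∈ A) (hy₁ : y₁ ∈ A)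
    (hℓ : ℓ ∈ A) :
    spec s ((W.baseChange M).toAffine.addY x₁ x₂ y₁ ℓ) =
      (W.baseChange (AlgebraicClosure K)).toAffine.addY (spec s x₁) (spec s x₂) (spec s y₁)
        (spec s ℓ) := by
  obtain ⟨x₁, rfl⟩ : ∃ x' : A, (x' : M) = x₁ := ⟨⟨x₁, hx₁⟩, rfl⟩
  obtain ⟨x₂, rfl⟩ : ∃ x' : A, (x' : M) = x₂ := ⟨⟨x₂, hx₂⟩, rfl⟩
  obtain ⟨y₁, rfl⟩ : ∃ x' : A, (x' : M) = y₁ := ⟨⟨y₁, hy₁⟩, rfl⟩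
  obtain ⟨ℓ, rfl⟩ : ∃ x' : A, (x' : M) = ℓ := ⟨⟨ℓ, hℓ⟩, rfl⟩
  have h1 : (W.baseChange M).toAffine.addY (x₁ : M) (x₂ : M) (y₁ : M) (ℓ : M) =
      (((W.baseChange A).toAffine.addY x₁ x₂ y₁ ℓ : A) : M) :=
    WeierstrassCurve.Affine.baseChange_addY (W' := W) A.val (x₁ := x₁) (x₂ := x₂) (y₁ := y₁)
      (ℓ := ℓ)
  have h2 : s ((W.baseChange A).toAffine.addY x₁ x₂ y₁ ℓ) =
      (W.baseChange (AlgebraicClosure K)).toAffine.addY (s x₁) (s x₂) (s y₁) (s ℓ) :=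
    (WeierstrassCurve.Affine.baseChange_addY (W' := W) s (x₁ := x₁) (x₂ := x₂) (y₁ := y₁)
      (ℓ := ℓ)).symm
  rw [h1, spec_coe, h2, spec_coe, spec_coe, spec_coe, spec_coe]

/-- `addY` of elements of `A` lies in `A`. [folklore] -/
theorem addY_mem {x₁ x₂ y₁ ℓ : M} (hx₁ : x₁ ∈ A) (hx₂ : x₂ ∈ A) (hy₁ : y₁ ∈ A)
    (hℓ : ℓ ∈ A) :
    (W.baseChange M).toAffine.addY x₁ x₂ y₁ ℓ ∈ A := by
  obtain ⟨x₁, rfl⟩ : ∃ x' : A, (x' : M) = x₁ := ⟨⟨x₁, hx₁⟩, rfl⟩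
  obtain ⟨x₂, rfl⟩ : ∃ x' : A, (x' : M) = x₂ := ⟨⟨x₂, hx₂⟩, rfl⟩
  obtain ⟨y₁, rfl⟩ : ∃ x' : A, (x' : M) = y₁ := ⟨⟨y₁, hy₁⟩, rfl⟩
  obtain ⟨ℓ, rfl⟩ : ∃ x' : A, (x' : M) = ℓ := ⟨⟨ℓ, hℓ⟩, rfl⟩
  rw [show (W.baseChange M).toAffine.addY (x₁ : M) (x₂ : M) (y₁ : M) (ℓ : M) =
      (((W.baseChange A).toAffine.addY x₁ x₂ y₁ ℓ : A) : M) from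
    WeierstrassCurve.Affine.baseChange_addY (W' := W) A.val (x₁ := x₁) (x₂ := x₂) (y₁ := y₁)
      (ℓ := ℓ)]
  exact SetLike.coe_mem _

/-- **Specializations preserve the Weierstrass equation.** [folklore] -/
theorem equation_spec {x y : M} (hx : x ∈ A) (hy : y ∈ A)
    (h : (W.baseChange M).toAffine.Equation x y) :
    (W.baseChange (AlgebraicClosure K)).toAffine.Equation (spec s x) (spec s y) := by
  rw [WeierstrassCurve.Affine.Equation] at h ⊢
  rw [← spec_evalEval_polynomial s hx hy, h, spec_zero]

end Transport

/-! ## Specializing points -/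

/-- The stock of an affine point `(x, y)`: its coordinates and the two partial derivatives
`W_X(x, y)`, `W_Y(x, y)` (one of which is non-zero), so that its specialization is again a
nonsingular point; empty for `O`. [folklore] -/
def ptStock : (W.baseChange M).toAffine.Point → Finset M
  | .zero => ∅
  | .some x y _ => {x, y, (W.baseChange M).toAffine.polynomialX.evalEval x y,
      (W.baseChange M).toAffine.polynomialY.evalEval x y}

/-- The stock of an addition `P + Q` of affine points: the two quantities `x_P - x_Q`,
`y_P - negY(Q)` whose vanishing decides the branch of the addition law. [folklore] -/
def addStock : (W.baseChange M).toAffine.Point → (W.baseChange M).toAffine.Point → Finset M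
  | .some x₁ y₁ _, .some x₂ y₂ _ =>
    {x₁ - x₂, y₁ - (W.baseChange M).toAffine.negY x₂ y₂}
  | _, _ => ∅

/-- The stock separating two affine points: the differences of their coordinates. [folklore] -/
def sepStock : (W.baseChange M).toAffine.Point → (W.baseChange M).toAffine.Point → Finset M
  | .some x₁ y₁ _, .some x₂ y₂ _ => {x₁ - x₂, y₁ - y₂}
  | _, _ => ∅

/-- **Specialization of points**: `(x, y) ↦ (spec x, spec y)` (the junk value `O` if this is not
a nonsingular point of `E(K̄)`, which does not happen on stocked points), `O ↦ O`. [folklore] -/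
def specPt : (W.baseChange M).toAffine.Point → (W.baseChange (AlgebraicClosure K)).toAffine.Point
  | .zero => 0
  | .some x y _ =>
    if h : (W.baseChange (AlgebraicClosure K)).toAffine.Nonsingular (spec s x) (spec s y) then
      .some _ _ h
    else 0

variable {W}

omit [IsScalarTower K (AlgebraicClosure K) M] in
/-- `specPt O = O`. [folklore] -/
@[simp] theorem specPt_zero : specPt W s (0 : (W.baseChange M).toAffine.Point) = 0 := rfl

omit [IsScalarTower K (AlgebraicClosure K) M] in
/-- `specPt (x, y) = (spec x, spec y)` as soon as the latter is a nonsingular point. [folklore] -/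
theorem specPt_some_of {x y : M} (hxy : (W.baseChange M).toAffine.Nonsingular x y)
    (h : (W.baseChange (AlgebraicClosure K)).toAffine.Nonsingular (spec s x) (spec s y)) :
    specPt W s (.some x y hxy) = .some _ _ h := by
  simp only [specPt, dif_pos h]

/-- A stocked affine point specializes to a nonsingular point. [folklore] -/
theorem nonsingular_spec {x y : M} (hxy : (W.baseChange M).toAffine.Nonsingular x y)
    (hP : Stocked A (ptStock W (.some x y hxy))) :
    (W.baseChange (AlgebraicClosure K)).toAffine.Nonsingular (spec s x) (spec s y) := by
  have hx : x ∈ A := hP.mem (by simp [ptStock])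
  have hy : y ∈ A := hP.mem (by simp [ptStock])
  refine ⟨equation_spec s hx hy hxy.1, ?_⟩
  rcases hxy.2 with h | h
  · left
    rwa [← spec_evalEval_polynomialX s hx hy, ne_eq, hP.spec_eq_zero_iff s (by simp [ptStock])]
  · right
    rwa [← spec_evalEval_polynomialY s hx hy, ne_eq, hP.spec_eq_zero_iff s (by simp [ptStock])]

/-- **Specialization of a stocked affine point** is the affine point `(spec x, spec y)`.
[folklore] -/
theorem specPt_some {x y : M} (hxy : (W.baseChange M).toAffine.Nonsingular x y)
    (hP : Stocked A (ptStock W (.some x y hxy))) :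
    specPt W s (.some x y hxy) = .some _ _ (nonsingular_spec s hxy hP) :=
  specPt_some_of s hxy _

/-- The specialization of a stocked affine point is not `O`. [folklore] -/
theorem specPt_some_ne_zero {x y : M} (hxy : (W.baseChange M).toAffine.Nonsingular x y)
    (hP : Stocked A (ptStock W (.some x y hxy))) : specPt W s (.some x y hxy) ≠ 0 := by
  rw [specPt_some s hxy hP]
  exact Affine.Point.some_ne_zero _

/-- **Specialization fixes the `K̄`-points**: `specPt (ι_* P₀) = P₀` for the inclusion
`ι_* : E(K̄) → E(M)`. [folklore] -/
theorem specPt_map (P₀ : (W.baseChange (AlgebraicClosure K)).toAffine.Point) :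
    specPt W s (Affine.Point.map (IsScalarTower.toAlgHom K (AlgebraicClosure K) M) P₀) =
      P₀ := by
  rcases P₀ with _ | ⟨x, y, h⟩
  · rfl
  · rw [Affine.Point.map_some]
    have hx : spec s (IsScalarTower.toAlgHom K (AlgebraicClosure K) M x) = x := spec_algebraMap s x
    have hy : spec s (IsScalarTower.toAlgHom K (AlgebraicClosure K) M y) = y := spec_algebraMap s y
    have h' : (W.baseChange (AlgebraicClosure K)).toAffine.Nonsingular
        (spec s (IsScalarTower.toAlgHom K (AlgebraicClosure K) M x))
        (spec s (IsScalarTower.toAlgHom K (AlgebraicClosure K) M y)) := by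
      rw [hx, hy]; exact h
    rw [specPt_some_of s _ h']
    congr 1


/-- **Specialization is additive on stocked points**: if the coordinates and partial derivatives
of the affine points `P, Q` and the branch quantities `x_P - x_Q`, `y_P - negY(Q)` of the addition
law are stocked, then `specPt (P + Q) = specPt P + specPt Q` (the addition law is given by the same
formulae over `M` and over `K̄`, Mathlib's `map_addX`, `map_addY`, and the specialization takes the
same branch). Silverman, *AEC*, III.2.3 (group law algorithm). [folklore] -/
theorem specPt_add (P Q : (W.baseChange M).toAffine.Point) (hP : Stocked A (ptStock W P))
    (hQ : Stocked A (ptStock W Q)) (hPQ : Stocked A (addStock W P Q)) :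
    specPt W s (P + Q) = specPt W s P + specPt W s Q := by
  rcases P with _ | ⟨x₁, y₁, h₁⟩
  · rw [← Affine.Point.zero_def, zero_add, specPt_zero, zero_add]
  rcases Q with _ | ⟨x₂, y₂, h₂⟩
  · rw [← Affine.Point.zero_def, add_zero, specPt_zero, add_zero]
  have hx₁ : x₁ ∈ A := hP.mem (by simp [ptStock])
  have hy₁ : y₁ ∈ A := hP.mem (by simp [ptStock])
  have hx₂ : x₂ ∈ A := hQ.mem (by simp [ptStock])
  have hy₂ : y₂ ∈ A := hQ.mem (by simp [ptStock])
  have h₁' := nonsingular_spec s h₁ hP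
  have h₂' := nonsingular_spec s h₂ hQ
  rw [specPt_some s h₁ hP, specPt_some s h₂ hQ]
  have ex : spec s x₁ = spec s x₂ ↔ x₁ = x₂ :=
    hPQ.spec_sub_eq_zero_iff s hx₁ hx₂ (by simp [addStock])
  have ey : spec s y₁ =
      (W.baseChange (AlgebraicClosure K)).toAffine.negY (spec s x₂) (spec s y₂) ↔
      y₁ = (W.baseChange M).toAffine.negY x₂ y₂ := by
    rw [← spec_negY s hx₂ hy₂]
    exact hPQ.spec_sub_eq_zero_iff s hy₁ (negY_mem hx₂ hy₂) (by simp [addStock])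
  by_cases hxy : x₁ = x₂ ∧ y₁ = (W.baseChange M).toAffine.negY x₂ y₂
  · rw [Affine.Point.add_of_Y_eq hxy.1 hxy.2, specPt_zero,
      Affine.Point.add_of_Y_eq (ex.mpr hxy.1) (ey.mpr hxy.2)]
  have hxy' : ¬(spec s x₁ = spec s x₂ ∧
      spec s y₁ =
        (W.baseChange (AlgebraicClosure K)).toAffine.negY (spec s x₂) (spec s y₂)) :=
    fun h ↦ hxy ⟨ex.mp h.1, ey.mp h.2⟩
  rw [Affine.Point.add_some hxy, Affine.Point.add_some hxy']
  -- the slope lies in `A` and specializes to the slope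
  have hWX : (W.baseChange M).toAffine.polynomialX.evalEval x₁ y₁ ∈ A :=
    hP.mem (by simp [ptStock])
  have hWY : (W.baseChange M).toAffine.polynomialY.evalEval x₁ y₁ ∈ A :=
    hP.mem (by simp [ptStock])
  have hWY' : ((W.baseChange M).toAffine.polynomialY.evalEval x₁ y₁)⁻¹ ∈ A :=
    hP.inv_mem (by simp [ptStock])
  have hℓ : (W.baseChange M).toAffine.slope x₁ x₂ y₁ y₂ ∈ A ∧
      spec s ((W.baseChange M).toAffine.slope x₁ x₂ y₁ y₂) =
        (W.baseChange (AlgebraicClosure K)).toAffine.slope (spec s x₁) (spec s x₂) (spec s y₁)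
          (spec s y₂) := by
    by_cases hx : x₁ = x₂
    · have hy : y₁ ≠ (W.baseChange M).toAffine.negY x₂ y₂ := fun h ↦ hxy ⟨hx, h⟩
      have hy' : spec s y₁ ≠
          (W.baseChange (AlgebraicClosure K)).toAffine.negY (spec s x₂) (spec s y₂) :=
        fun h ↦ hy (ey.mp h)
      subst hx
      have hyy : y₁ = y₂ := Affine.Y_eq_of_Y_ne h₁.1 h₂.1 rfl hy
      subst hyy
      rw [Affine.slope_of_Y_ne_eq_evalEval rfl hy, Affine.slope_of_Y_ne_eq_evalEval rfl hy']
      refine ⟨?_, ?_⟩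
      · rw [div_eq_mul_inv]
        exact mul_mem (neg_mem hWX) hWY'
      · rw [spec_div s (neg_mem hWX) hWY hWY', spec_neg s hWX,
          spec_evalEval_polynomialX s hx₁ hy₁, spec_evalEval_polynomialY s hx₁ hy₁]
    · have hx' : spec s x₁ ≠ spec s x₂ := fun h ↦ hx (ex.mp h)
      rw [Affine.slope_of_X_ne hx, Affine.slope_of_X_ne hx']
      have hd : (x₁ - x₂)⁻¹ ∈ A := hPQ.inv_mem (by simp [addStock])
      refine ⟨?_, ?_⟩
      · rw [div_eq_mul_inv]
        exact mul_mem (sub_mem hy₁ hy₂) hd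
      · rw [spec_div s (sub_mem hy₁ hy₂) (sub_mem hx₁ hx₂) hd, spec_sub s hy₁ hy₂,
          spec_sub s hx₁ hx₂]
  have hX : spec s ((W.baseChange M).toAffine.addX x₁ x₂
      ((W.baseChange M).toAffine.slope x₁ x₂ y₁ y₂)) =
      (W.baseChange (AlgebraicClosure K)).toAffine.addX (spec s x₁) (spec s x₂)
        ((W.baseChange (AlgebraicClosure K)).toAffine.slope (spec s x₁) (spec s x₂)
          (spec s y₁) (spec s y₂)) := by
    rw [spec_addX s hx₁ hx₂ hℓ.1, hℓ.2]
  have hY : spec s ((W.baseChange M).toAffine.addY x₁ x₂ y₁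
      ((W.baseChange M).toAffine.slope x₁ x₂ y₁ y₂)) =
      (W.baseChange (AlgebraicClosure K)).toAffine.addY (spec s x₁) (spec s x₂) (spec s y₁)
        ((W.baseChange (AlgebraicClosure K)).toAffine.slope (spec s x₁) (spec s x₂)
          (spec s y₁) (spec s y₂)) := by
    rw [spec_addY s hx₁ hx₂ hy₁ hℓ.1, hℓ.2]
  have hns : (W.baseChange (AlgebraicClosure K)).toAffine.Nonsingular
      (spec s ((W.baseChange M).toAffine.addX x₁ x₂
        ((W.baseChange M).toAffine.slope x₁ x₂ y₁ y₂)))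
      (spec s ((W.baseChange M).toAffine.addY x₁ x₂ y₁
        ((W.baseChange M).toAffine.slope x₁ x₂ y₁ y₂))) := by
    rw [hX, hY]
    exact Affine.nonsingular_add h₁' h₂' hxy'
  rw [specPt_some_of s _ hns]
  congr 1

/-- **Specializations separate stocked points**: if the stocked points `P, Q` have the same
specialization and the differences of their coordinates are stocked, then `P = Q`. [folklore] -/
theorem eq_of_specPt_eq {P Q : (W.baseChange M).toAffine.Point} (hP : Stocked A (ptStock W P))
    (hQ : Stocked A (ptStock W Q)) (hPQ : Stocked A (sepStock W P Q))
    (h : specPt W s P = specPt W s Q) : P = Q := by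
  rcases P with _ | ⟨x₁, y₁, h₁⟩ <;> rcases Q with _ | ⟨x₂, y₂, h₂⟩
  · rfl
  · rw [← Affine.Point.zero_def, specPt_zero] at h
    exact ((specPt_some_ne_zero s h₂ hQ) h.symm).elim
  · rw [← Affine.Point.zero_def, specPt_zero] at h
    exact ((specPt_some_ne_zero s h₁ hP) h).elim
  · rw [specPt_some s h₁ hP, specPt_some s h₂ hQ, Affine.Point.some.injEq] at h
    have hx₁ : x₁ ∈ A := hP.mem (by simp [ptStock])
    have hy₁ : y₁ ∈ A := hP.mem (by simp [ptStock])
    have hx₂ : x₂ ∈ A := hQ.mem (by simp [ptStock])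
    have hy₂ : y₂ ∈ A := hQ.mem (by simp [ptStock])
    have ex : x₁ = x₂ := (hPQ.spec_sub_eq_zero_iff s hx₁ hx₂ (by simp [sepStock])).mp h.1
    have ey : y₁ = y₂ := (hPQ.spec_sub_eq_zero_iff s hy₁ hy₂ (by simp [sepStock])).mp h.2
    subst ex ey
    rfl




/-! ## `K̄`-rational and generic points of `E(M)` -/

section Generic

omit [Algebra K M] [IsScalarTower K (AlgebraicClosure K) M] in
/-- If `x - c` is stocked for every `c` in a finite set `B ⊆ K̄` (embedded in `M`) and
`x ∉ K̄`, then the specialization of `x` avoids `B`. [folklore] -/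
theorem spec_not_mem_of_stocked {x : M} (hx : x ∉ Set.range (algebraMap (AlgebraicClosure K) M))
    {B : Finset (AlgebraicClosure K)}
    (hB : Stocked A (B.image fun c ↦ x - algebraMap (AlgebraicClosure K) M c)) (hxA : x ∈ A) :
    spec s x ∉ B := by
  intro hmem
  have hu : x - algebraMap (AlgebraicClosure K) M (spec s x) ∈
      B.image fun c ↦ x - algebraMap (AlgebraicClosure K) M c :=
    Finset.mem_image_of_mem _ hmem
  have h0 : spec s (x - algebraMap (AlgebraicClosure K) M (spec s x)) = 0 := by
    rw [spec_sub s hxA (A.algebraMap_mem _), spec_algebraMap, sub_self]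
  rw [hB.spec_eq_zero_iff s hu, sub_eq_zero] at h0
  exact hx ⟨spec s x, h0.symm⟩

/-- An affine point of `E(M)` comes from `E(K̄)` iff its coordinates lie in `K̄`. [folklore] -/
theorem some_mem_range_map_iff {x y : M} (h : (W.baseChange M).toAffine.Nonsingular x y) :
    (.some x y h : (W.baseChange M).toAffine.Point) ∈
        Set.range (Affine.Point.map (IsScalarTower.toAlgHom K (AlgebraicClosure K) M)) ↔
      x ∈ Set.range (algebraMap (AlgebraicClosure K) M) ∧
        y ∈ Set.range (algebraMap (AlgebraicClosure K) M) := by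
  constructor
  · rintro ⟨P₀, hP₀⟩
    rcases P₀ with _ | ⟨x₀, y₀, h₀⟩
    · exact (Affine.Point.some_ne_zero h (hP₀.symm.trans rfl)).elim
    · rw [Affine.Point.map_some, Affine.Point.some.injEq] at hP₀
      exact ⟨⟨x₀, hP₀.1⟩, ⟨y₀, hP₀.2⟩⟩
  · rintro ⟨⟨x₀, rfl⟩, ⟨y₀, rfl⟩⟩
    have h₀ : (W.baseChange (AlgebraicClosure K)).toAffine.Nonsingular x₀ y₀ :=
      (Affine.baseChange_nonsingular (W := W)
        (hf := (IsScalarTower.toAlgHom K (AlgebraicClosure K) M).injective) x₀ y₀).mp h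
    exact ⟨.some x₀ y₀ h₀, by rw [Affine.Point.map_some]; rfl⟩

/-- The `y`-coordinate of a point of `E(M)` whose `x`-coordinate lies in `K̄` is integral over
`K̄` (the Weierstrass equation is monic in `y`), hence lies in `K̄`. [folklore] -/
theorem Y_mem_range_of_X_mem_range {x y : M} (h : (W.baseChange M).toAffine.Equation x y)
    (hx : x ∈ Set.range (algebraMap (AlgebraicClosure K) M)) :
    y ∈ Set.range (algebraMap (AlgebraicClosure K) M) := by
  obtain ⟨x₀, rfl⟩ := hx
  apply mem_range_algebraMap_of_isIntegral
  let W₀ := W.baseChange (AlgebraicClosure K)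
  refine ⟨Polynomial.X ^ 2 + Polynomial.C (W₀.a₁ * x₀ + W₀.a₃) * Polynomial.X -
    Polynomial.C (x₀ ^ 3 + W₀.a₂ * x₀ ^ 2 + W₀.a₄ * x₀ + W₀.a₆), ?_, ?_⟩
  · monicity!
  · rw [Affine.equation_iff'] at h
    simp only [Polynomial.eval₂_add, Polynomial.eval₂_sub, Polynomial.eval₂_mul,
      Polynomial.eval₂_pow, Polynomial.eval₂_X, Polynomial.eval₂_C, map_add, map_mul, map_pow]
    have ha₁ : algebraMap (AlgebraicClosure K) M W₀.a₁ = (W.baseChange M).toAffine.a₁ :=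
      (IsScalarTower.algebraMap_apply K (AlgebraicClosure K) M W.a₁).symm
    have ha₂ : algebraMap (AlgebraicClosure K) M W₀.a₂ = (W.baseChange M).toAffine.a₂ :=
      (IsScalarTower.algebraMap_apply K (AlgebraicClosure K) M W.a₂).symm
    have ha₃ : algebraMap (AlgebraicClosure K) M W₀.a₃ = (W.baseChange M).toAffine.a₃ :=
      (IsScalarTower.algebraMap_apply K (AlgebraicClosure K) M W.a₃).symm
    have ha₄ : algebraMap (AlgebraicClosure K) M W₀.a₄ = (W.baseChange M).toAffine.a₄ :=
      (IsScalarTower.algebraMap_apply K (AlgebraicClosure K) M W.a₄).symm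
    have ha₆ : algebraMap (AlgebraicClosure K) M W₀.a₆ = (W.baseChange M).toAffine.a₆ :=
      (IsScalarTower.algebraMap_apply K (AlgebraicClosure K) M W.a₆).symm
    rw [ha₁, ha₂, ha₃, ha₄, ha₆]
    linear_combination h

/-- The `x`-coordinate of a point of `E(M)` whose `y`-coordinate lies in `K̄` is integral over
`K̄` (the Weierstrass equation is monic in `x`), hence lies in `K̄`. [folklore] -/
theorem X_mem_range_of_Y_mem_range {x y : M} (h : (W.baseChange M).toAffine.Equation x y)
    (hy : y ∈ Set.range (algebraMap (AlgebraicClosure K) M)) :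
    x ∈ Set.range (algebraMap (AlgebraicClosure K) M) := by
  obtain ⟨y₀, rfl⟩ := hy
  apply mem_range_algebraMap_of_isIntegral
  let W₀ := W.baseChange (AlgebraicClosure K)
  refine ⟨Polynomial.X ^ 3 + Polynomial.C W₀.a₂ * Polynomial.X ^ 2 +
    Polynomial.C (W₀.a₄ - W₀.a₁ * y₀) * Polynomial.X +
    Polynomial.C (W₀.a₆ - y₀ ^ 2 - W₀.a₃ * y₀), ?_, ?_⟩
  · monicity!
  · rw [Affine.equation_iff'] at h
    simp only [Polynomial.eval₂_add, Polynomial.eval₂_sub, Polynomial.eval₂_mul,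
      Polynomial.eval₂_pow, Polynomial.eval₂_X, Polynomial.eval₂_C, map_sub, map_mul, map_pow]
    have ha₁ : algebraMap (AlgebraicClosure K) M W₀.a₁ = (W.baseChange M).toAffine.a₁ :=
      (IsScalarTower.algebraMap_apply K (AlgebraicClosure K) M W.a₁).symm
    have ha₂ : algebraMap (AlgebraicClosure K) M W₀.a₂ = (W.baseChange M).toAffine.a₂ :=
      (IsScalarTower.algebraMap_apply K (AlgebraicClosure K) M W.a₂).symm
    have ha₃ : algebraMap (AlgebraicClosure K) M W₀.a₃ = (W.baseChange M).toAffine.a₃ :=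
      (IsScalarTower.algebraMap_apply K (AlgebraicClosure K) M W.a₃).symm
    have ha₄ : algebraMap (AlgebraicClosure K) M W₀.a₄ = (W.baseChange M).toAffine.a₄ :=
      (IsScalarTower.algebraMap_apply K (AlgebraicClosure K) M W.a₄).symm
    have ha₆ : algebraMap (AlgebraicClosure K) M W₀.a₆ = (W.baseChange M).toAffine.a₆ :=
      (IsScalarTower.algebraMap_apply K (AlgebraicClosure K) M W.a₆).symm
    rw [ha₁, ha₂, ha₃, ha₄, ha₆]
    linear_combination (-1 : M) * h

/-- **Generic points have both coordinates outside `K̄`.** If an affine point of `E(M)` does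
not come from `E(K̄)` then neither of its coordinates lies in `K̄` (`K̄` being algebraically
closed in `M`). [folklore] -/
theorem not_mem_range_of_not_mem_range_map {x y : M}
    (h : (W.baseChange M).toAffine.Nonsingular x y)
    (hP : (.some x y h : (W.baseChange M).toAffine.Point) ∉
      Set.range (Affine.Point.map (IsScalarTower.toAlgHom K (AlgebraicClosure K) M))) :
    x ∉ Set.range (algebraMap (AlgebraicClosure K) M) ∧
      y ∉ Set.range (algebraMap (AlgebraicClosure K) M) := by
  rw [some_mem_range_map_iff] at hP
  constructor
  · exact fun hx ↦ hP ⟨hx, Y_mem_range_of_X_mem_range h.1 hx⟩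
  · exact fun hy ↦ hP ⟨X_mem_range_of_Y_mem_range h.1 hy, hy⟩

end Generic

end WeierstrassCurve
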